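import Summits.KontsevichZagierPeriods.KontsevichZagierPeriods.Theorems.TerasomaMultiplicationBetaCancellationStubTameFormAux21

/-!
# `BetaCancellation` (stmt-KontsevichZagierPeriods-13633), line `divisor-slicing-transshipment` — stub `stub_tameForm`, auxiliary file 22: the shadow of a straightened Newton–Leibniz cell

* `Shadow.of_stabPair` — a representation and its stabilisation `Z × (0,1)ᴺ⁻ⁿ` have the same
  `K₀`-shadow (identity pieces);
* `exists_straightenShadow` — for a positive Newton–Leibniz cell `(T, f)` as in auxiliary file 21,
  the boundary-term representation `Q = (S × (0,1), F(·, hi) − F(·, lo))` exists (integrability by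
  the change-of-variables theorem along the straightening chart,
  `MeasureTheory.integrableOn_image_iff_integrableOn_abs_det_fderiv_smul`) and `[T, f] − [Q]` has
  vanishing shadow (the chart is a one-piece `MIso`).

References: M. Kontsevich, D. Zagier, *Periods* (2001), §1.2 rule (3); crux NOTES c6 (F13).
-/

noncomputable section

-- `Summit.KontsevichZagierPeriods.KontsevichZagierPeriods.…` is the tree's mandated layout (single-conjunct summit).
set_option linter.dupNamespace false

namespace Summit.KontsevichZagierPeriods.KontsevichZagierPeriods.BetaCancellationDivisorSlicing

open MeasureTheory Set Function Filter
open scoped Topology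
open Literature.NumberTheory.Transcendental
open Literature.NumberTheory.Transcendental.KZ
open Literature.ModelTheory.ExponentialFields (IsSemialgebraic isSemialgebraic_univ)

variable {n N : ℕ}

/-! ### Stabilisation does not change the shadow -/

/-- **A representation and its stabilisation have the same shadow.** [folklore] -/
theorem Shadow.of_stabPair (Z : IntegralRep n) (Zs : IntegralRep N) (h : n ≤ N) (hd : Zs.domain = stabSet h Z.domain)
    (hi : Zs.integrand = stabFun h Z.integrand) : Nonempty (Shadow (of Z - of Zs)) := by
  have hpos : posSet Zs = stabSet h (posSet Z) := by
    ext z; simp only [mem_posSet, hd, hi, mem_stabSet, stabFun_apply]; tauto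
  have hneg : negSet Zs = stabSet h (negSet Z) := by
    ext z; simp only [mem_negSet, hd, hi, mem_stabSet, stabFun_apply]; tauto
  refine ⟨⟨1, 1, fun _ => ⟨n, Z⟩, fun _ => ⟨N, Zs⟩, by simp, N, fun _ => h, fun _ => le_rfl, Classical.choice ?_⟩⟩
  refine MIso.of_idPieces (P₀ := Unit ⊕ Unit) (Sum.map (fun _ => 0) (fun _ => 0)) (Sum.map (fun _ => 0) (fun _ => 0))
    (Sum.elim (fun _ => stabSet h (posSet Z)) (fun _ => stabSet h (negSet Z))) ?_ ?_ ?_ ?_ ?_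
  · rintro (_ | _)
    · refine ⟨isSemialgebraic_stabSet h (isSemialgebraic_posSet Z), ?_, ?_, fun z _ => ?_⟩
      · simp [liftSet_eq h]
      · simp [hpos]
      · simp [liftFun_eq h, hi]
    · refine ⟨isSemialgebraic_stabSet h (isSemialgebraic_negSet Z), ?_, ?_, fun z _ => ?_⟩
      · simp [hneg]
      · simp [liftSet_eq h]
      · simp [liftFun_eq h, hi]
  · rintro (_ | _) (_ | _) hne hst <;> first | exact (hne rfl).elim | simp at hst
  · rintro (_ | _) (_ | _) hne hst <;> first | exact (hne rfl).elim | simp at hst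
  · rintro (i | j)
    · refine measure_mono_null (fun z hz => ?_) measure_empty
      simp only [Set.mem_sdiff, Sum.elim_inl, liftSet_eq h, mem_iUnion, exists_prop, not_exists, not_and] at hz
      exact hz.2 (Sum.inl ()) (by simp [Subsingleton.elim i 0]) hz.1
    · refine measure_mono_null (fun z hz => ?_) measure_empty
      simp only [Set.mem_sdiff, Sum.elim_inr, liftSet_self, hneg, mem_iUnion, exists_prop, not_exists, not_and] at hz
      exact hz.2 (Sum.inr ()) (by simp [Subsingleton.elim j 0]) hz.1
  · rintro (j | i)
    · refine measure_mono_null (fun z hz => ?_) measure_empty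
      simp only [Set.mem_sdiff, Sum.elim_inl, liftSet_self, hpos, mem_iUnion, exists_prop, not_exists, not_and] at hz
      exact hz.2 (Sum.inl ()) (by simp [Subsingleton.elim j 0]) hz.1
    · refine measure_mono_null (fun z hz => ?_) measure_empty
      simp only [Set.mem_sdiff, Sum.elim_inr, liftSet_eq h, mem_iUnion, exists_prop, not_exists, not_and] at hz
      exact hz.2 (Sum.inr ()) (by simp [Subsingleton.elim i 0]) hz.1

/-! ### The straightened cell -/

/-- **The boundary-term representation of a positive Newton–Leibniz cell and the vanishing of the
shadow of `[cell] − [boundary term]`.** [cite: KontsevichZagier2001, §1.2 rule (3)] -/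
theorem exists_straightenShadow {S : Set (Fin n → ℝ)} (hSo : IsOpen S) (hS : IsSemialgebraic ℚ S)
    {lo hi : (Fin n → ℝ) → ℝ} (hlo : IsSemialgebraicFunOn ℚ S lo) (hhi : IsSemialgebraicFunOn ℚ S hi)
    (hloc : ContinuousOn lo S) (hhic : ContinuousOn hi S) (hlh : ∀ x ∈ S, lo x < hi x)
    (RT : IntegralRep (n + 1)) (hRT : RT.domain = {z : Fin (n + 1) → ℝ | (Fin.init z : Fin n → ℝ) ∈ S ∧
      lo (Fin.init z) < z (Fin.last n) ∧ z (Fin.last n) < hi (Fin.init z)})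
    {F : (Fin (n + 1) → ℝ) → ℝ} (hFs : IsSemialgebraicFunOn ℚ RT.domain F)
    (hFd : ∀ z ∈ RT.domain, DifferentiableAt ℝ F z)
    (hFc : ∀ x ∈ S, ContinuousOn (fun t => F (Fin.snoc x t)) (Icc (lo x) (hi x)))
    (hFt : ∀ x ∈ S, ∀ t ∈ Ioo (lo x) (hi x), HasDerivAt (fun s => F (Fin.snoc x s)) (RT.integrand (Fin.snoc x t)) t)
    (hpos : ∀ x ∈ S, ∀ t ∈ Ioo (lo x) (hi x), 0 < RT.integrand (Fin.snoc x t))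
    (hGlo : IsSemialgebraicFunOn ℚ S (fun x => F (Fin.snoc x (lo x))))
    (hGhi : IsSemialgebraicFunOn ℚ S (fun x => F (Fin.snoc x (hi x))))
    (hGlod : DifferentiableOn ℝ (fun x => F (Fin.snoc x (lo x))) S)
    (hGhid : DifferentiableOn ℝ (fun x => F (Fin.snoc x (hi x))) S) :
    ∃ Q : IntegralRep (n + 1), Q.domain = {z : Fin (n + 1) → ℝ | (Fin.init z : Fin n → ℝ) ∈ S ∧
        z (Fin.last n) ∈ Ioo (0 : ℝ) 1} ∧
      (Q.integrand = fun z => F (Fin.snoc (Fin.init z) (hi (Fin.init z))) - F (Fin.snoc (Fin.init z) (lo (Fin.init z)))) ∧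
      Nonempty (Shadow (of RT - of Q)) := by
  rw [hRT] at hFs hFd
  obtain ⟨Ψ', hΔpos, hsa, hinj, hder, himage⟩ := exists_straightenPiece hSo hS hlo hhi hloc hhic hlh hFs hFd hFc
    hFt hpos hGlo hGhi hGlod hGhid
  set T := {z : Fin (n + 1) → ℝ | (Fin.init z : Fin n → ℝ) ∈ S ∧ lo (Fin.init z) < z (Fin.last n) ∧
    z (Fin.last n) < hi (Fin.init z)} with hT_def
  set Θ : (Fin (n + 1) → ℝ) → (Fin (n + 1) → ℝ) := fun w => Fin.snoc (Fin.init w)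
    ((F w - F (Fin.snoc (Fin.init w) (lo (Fin.init w)))) /
      (F (Fin.snoc (Fin.init w) (hi (Fin.init w))) - F (Fin.snoc (Fin.init w) (lo (Fin.init w))))) with hΘ_def
  set ΔG : (Fin n → ℝ) → ℝ := fun x => F (Fin.snoc x (hi x)) - F (Fin.snoc x (lo x)) with hΔG_def
  have hTsa : IsSemialgebraic ℚ T := hRT ▸ RT.isSemialgebraic_domain
  have hTm : MeasurableSet T := Literature.ModelTheory.ExponentialFields.IsSemialgebraic.measurableSet_holds hTsa
  have hposT : ∀ z ∈ T, 0 < RT.integrand z := fun z hz => by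
    have := hpos _ hz.1 (z (Fin.last n)) ⟨hz.2.1, hz.2.2⟩
    rwa [Fin.snoc_init_self] at this
  -- the boundary-term representation
  have hQd : IsSemialgebraic ℚ {z : Fin (n + 1) → ℝ | (Fin.init z : Fin n → ℝ) ∈ S ∧ z (Fin.last n) ∈ Ioo (0 : ℝ) 1} := by
    have : {z : Fin (n + 1) → ℝ | (Fin.init z : Fin n → ℝ) ∈ S ∧ z (Fin.last n) ∈ Ioo (0 : ℝ) 1} = stabSet n.le_succ S := by
      ext z; rw [mem_stabSet_succ]; rfl
    rw [this]; exact isSemialgebraic_stabSet _ hS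
  have hQs : IsSemialgebraicFunOn ℚ {z : Fin (n + 1) → ℝ | (Fin.init z : Fin n → ℝ) ∈ S ∧ z (Fin.last n) ∈ Ioo (0 : ℝ) 1}
      (fun z => ΔG (Fin.init z)) :=
    (IsSemialgebraicFunOn.sub_holds hGhi hGlo).comp_init_mono hQd fun _ h => h.1
  have hQi : IntegrableOn (fun z : Fin (n + 1) → ℝ => ΔG (Fin.init z))
      {z : Fin (n + 1) → ℝ | (Fin.init z : Fin n → ℝ) ∈ S ∧ z (Fin.last n) ∈ Ioo (0 : ℝ) 1} := by
    rw [← himage, integrableOn_image_iff_integrableOn_abs_det_fderiv_smul volume hTm (fun z hz => (hder z hz).1) hinj]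
    refine (RT.integrableOn.mono_set (by rw [hRT])).congr_fun (fun z hz => ?_) hTm
    rw [(hder z hz).2, hΘ_def]
    simp only [Fin.init_snoc, smul_eq_mul]
    have hΔ := hΔpos _ hz.1
    rw [abs_of_pos (div_pos (hposT z hz) hΔ)]
    field_simp
    simp [hΔG_def]
  let Q : IntegralRep (n + 1) := ⟨_, _, hQd, hQs, hQi⟩
  refine ⟨Q, rfl, rfl, ?_⟩
  -- the one-piece `MIso`
  have hposQ : posSet Q = {z : Fin (n + 1) → ℝ | (Fin.init z : Fin n → ℝ) ∈ S ∧ z (Fin.last n) ∈ Ioo (0 : ℝ) 1} := by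
    ext z; simp only [mem_posSet, Q, mem_setOf_eq]
    exact ⟨fun h => h.1, fun h => ⟨h, hΔpos _ h.1⟩⟩
  have hnegQ : negSet Q = ∅ := by
    ext z; simp only [mem_negSet, Q, mem_setOf_eq, mem_empty_iff_false, iff_false, not_and, not_lt]
    exact fun h => (hΔpos _ h.1).le
  have hposR : posSet RT = T := by
    ext z; simp only [mem_posSet, hRT]
    exact ⟨fun h => h.1, fun h => ⟨h, hposT z h⟩⟩
  have hnegR : negSet RT = ∅ := by
    ext z; simp only [mem_negSet, hRT, mem_empty_iff_false, iff_false, not_and, not_lt]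
    exact fun h => (hposT z h).le
  refine ⟨⟨1, 1, fun _ => ⟨n + 1, RT⟩, fun _ => ⟨n + 1, Q⟩, by simp, n + 1, fun _ => le_rfl, fun _ => le_rfl,
    Classical.choice ?_⟩⟩
  refine MIso.of_fintype (P₀ := Unit) (fun _ => Sum.inl 0) (fun _ => Sum.inl 0) (fun _ => T) (fun _ => Θ) (fun _ => Ψ')
    (fun _ => ⟨hTsa, ?_, hsa, hinj, fun z hz => (hder z hz).1, ?_, fun z hz => ?_⟩) (fun _ _ h _ => (h rfl).elim)
    (fun _ _ h _ => (h rfl).elim) ?_ ?_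
  · simp [hposR]
  · simp only [Sum.elim_inl, liftSet_self, hposQ, himage]; rfl
  · simp only [Sum.elim_inl, liftFun_self, (hder z hz).2, hΘ_def, Fin.init_snoc, Q]
    have hΔ := hΔpos _ hz.1
    rw [abs_of_pos (div_pos (hposT z hz) hΔ)]
    field_simp
    simp [hΔG_def]
  · rintro (i | j)
    · refine measure_mono_null (fun z hz => ?_) measure_empty
      simp only [Set.mem_sdiff, Sum.elim_inl, liftSet_self, hposR, mem_iUnion, exists_prop, not_exists, not_and] at hz
      exact hz.2 () (by simp [Subsingleton.elim i 0]) hz.1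
    · simp [hnegQ]
  · rintro (j | i)
    · refine measure_mono_null (fun z hz => ?_) measure_empty
      simp only [Set.mem_sdiff, Sum.elim_inl, liftSet_self, hposQ, mem_iUnion, exists_prop, not_exists, not_and] at hz
      have hz1 := hz.1
      rw [← himage] at hz1
      exact hz.2 () (by simp [Subsingleton.elim j 0]) hz1
    · simp [hnegR]

/-! ### Headline -/

/-- Registered helper goal of the stub `stub_tameForm`: a representation and its stabilisation have
the same shadow. [folklore] -/
theorem tameForm_aux_stabPair : ∀ {n N : ℕ} (Z : IntegralRep n) (Zs : IntegralRep N) (h : n ≤ N), Zs.domain = stabSet h Z.domain → Zs.integrand = stabFun h Z.integrand → Nonempty (Shadow (of Z - of Zs)) :=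
  fun Z Zs h hd hi => Shadow.of_stabPair Z Zs h hd hi

end Summit.KontsevichZagierPeriods.KontsevichZagierPeriods.BetaCancellationDivisorSlicing

end
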